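import Summits.RiemannHypothesis.RiemannHypothesis.Theorems.OddSectorOddOneSignedWindowsTwoLevelProximity
import Literature.NumberTheory.LFunctions.WeilGroundEnergyParitySplit
import HarnessLib

/-!
# Proximity from tightness (stub K2a of line `SketchIdeator5`, crux `OddSector.OddOneSignedWindows`)
(item stmt-RiemannHypothesis-17778, stub `stub_proximityOfTight`; RH-free)

Let `u` be an odd-sector ground state of Weil's windowed form `Q` at window `a` (energy
`ε = weilOddGroundEnergy a`), `v : Fin K → ℝ → ℂ` square integrable, `θ, Δ > 0`, `q = θe^{-4a}`,
and assume (o) `0 < ε`; (i) every ADMISSIBLE `R` (one with `R − δ ≤ Re Q(gₙ)` eventually, for all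
`δ > 0`, along every sequence of odd unit window tests `gₙ → w` in `L²`, for every unit vector
`w = Σ cᵢ vᵢ` of the block span) has `R/(1+q) ≤ Re Q` on the odd unit test sphere; (ii') a
relative odd gap `Re Q ≥ (1+Δ)ε` on the odd unit tests orthogonal to some `z ∈ L²`. Then some
unit `w = Σ cᵢ vᵢ` has `1 − |⟨u, w⟩|² ≤ 2q/Δ` (`proximityOfTight`; registered uncurried
`let`-tower form `stub_proximityOfTight`, with two-level proximity P1 as a hypothesis).

Proof. (1) The admissible `R` form a set `S ∋ ε`, bounded above by (i); its supremum `R*` is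
admissible, so `R* ≤ (1+q)ε`, while `R* + qε ∉ S`: some unit `w` of the span is the `L²`-limit
of odd unit tests `gₙ` with `Re Q(gₙ) < (1+2q)ε` frequently. (2) GAP TRANSFER `z ↦ u`
(`gapTransfer`, via `integral_mul_conj_ne_zero_of_oddGap`: `⟨u, z⟩ ≠ 0`): `m = (1+Δ)ε` also
bounds `Re Q` on the odd unit tests `⊥ u` (rotate `h ↦ h − (⟨h,z⟩/⟨kₙ,z⟩)kₙ ⊥ z` along the odd
minimising sequence `kₙ → u` of the weak Euler–Lagrange identity and pass to the limit).
(3) P1 with `m₂ = (1+Δ)ε` along `gₙ`: `1 − |⟨u,gₙ⟩|² ≤ (Re Q(gₙ) − ε)/(Δε) < 2q/Δ` frequently,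
and `⟨u,gₙ⟩ → ⟨u,w⟩`.

References: Reed–Simon IV, Thm XIII.1–2 (min–max); E. Bombieri, Rend. Lincei (9) 11 (2000), §4
Lemma 1 / (4.2), Thm 3, Thm 5. Patterns adapted from `…TwoLevelProximity.lean` (stub P1).
-/

noncomputable section

set_option linter.dupNamespace false

open Complex Filter Set MeasureTheory
open scoped Real Topology ComplexConjugate

namespace Summit.RiemannHypothesis.RiemannHypothesis.Theorems.OddSector

open Literature.NumberTheory.LFunctions
open Literature.NumberTheory.LFunctions.ConnesVanSuijlekom
open Summit.RiemannHypothesis.RiemannHypothesis.Theorems.GroundStatesConvergeToXi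

/-- A real sequence converging to `L` which is frequently `< C` has `L ≤ C` (pass to a
subsequence along which the strict inequality always holds). [folklore] -/
theorem le_of_tendsto_of_frequently_lt {f : ℕ → ℝ} {L C : ℝ} (hf : Tendsto f atTop (𝓝 L))
    (hC : ∃ᶠ n in atTop, f n < C) : L ≤ C := by
  obtain ⟨φ, hφ, hlt⟩ := extraction_of_frequently_atTop hC
  exact le_of_tendsto' (hf.comp hφ.tendsto_atTop) fun n => (hlt n).le

/-- **Limit passage of the gap transfer.** If `μₙ → ν`, `Aₙ → A₀`, `Pₙ → P₀` in `ℂ`,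
`Qkₙ → κ`, `Qgₙ → ε` in `ℝ`, and eventually
`m (1 + |μₙ|² E + 2 Re(μ̄ₙ Pₙ)) ≤ Qkₙ + |μₙ|² Qgₙ + 2 Re(μₙ Aₙ)`, then the same inequality holds
between the limits. [folklore] -/
theorem gapTransfer_limit {m E κ ε : ℝ} {ν A₀ P₀ : ℂ} {μ A P : ℕ → ℂ} {Qk Qg : ℕ → ℝ}
    (hμ : Tendsto μ atTop (𝓝 ν)) (hA : Tendsto A atTop (𝓝 A₀)) (hP : Tendsto P atTop (𝓝 P₀))
    (hQk : Tendsto Qk atTop (𝓝 κ)) (hQg : Tendsto Qg atTop (𝓝 ε))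
    (hstep : ∀ᶠ n in atTop, m * (1 + ‖μ n‖ ^ 2 * E + 2 * (conj (μ n) * P n).re) ≤
      Qk n + ‖μ n‖ ^ 2 * Qg n + 2 * (μ n * A n).re) :
    m * (1 + ‖ν‖ ^ 2 * E + 2 * (conj ν * P₀).re) ≤ κ + ‖ν‖ ^ 2 * ε + 2 * (ν * A₀).re := by
  have hn2 : Tendsto (fun n => ‖μ n‖ ^ 2) atTop (𝓝 (‖ν‖ ^ 2)) := (hμ.norm).pow 2
  have h1 : Tendsto (fun n => (μ n * A n).re) atTop (𝓝 ((ν * A₀).re)) :=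
    (Complex.continuous_re.tendsto _).comp (hμ.mul hA)
  have h2 : Tendsto (fun n => (conj (μ n) * P n).re) atTop (𝓝 ((conj ν * P₀).re)) :=
    (Complex.continuous_re.tendsto _).comp (((Complex.continuous_conj.tendsto _).comp hμ).mul hP)
  exact le_of_tendsto_of_tendsto
    (((tendsto_const_nhds.add (hn2.mul_const E)).add (h2.const_mul 2)).const_mul m)
    ((hQk.add (hn2.mul hQg)).add (h1.const_mul 2)) hstep

/-- **One step of the gap transfer.** If `m ≤ Re Q` on the `L²`-normalised smooth odd window tests
orthogonal to `z` (hypothesis `H`), then for odd window tests `f, g` and `μ : ℂ` with `f + μ g ⊥ z`: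
`m (∫|f|² + |μ|² ∫|g|² + 2 Re(μ̄ ⟨f, g⟩)) ≤ Re Q(f) + |μ|² Re Q(g) + 2 Re(μ W(g ⋆ f̃))` (un-normalise,
`mul_integral_norm_sq_le_re_of_orthogonal`; expand by polarisation, `re_weilQuadratic_add_const_mul`,
`integral_norm_sq_add_mul`). [cite: Bombieri2000Weil, §3–§4 (the hermitian form attached to T)] -/
theorem gapTransfer_step {a m : ℝ} {z f g : ℝ → ℂ} (μ : ℂ)
    (H : ∀ h : ℝ → ℂ, IsWeilTest h → tsupport h ⊆ Icc (-a) a → (∀ t, h (-t) = -h t) →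
      ∫ t, ‖h t‖ ^ 2 = (1 : ℝ) → ∫ t, h t * conj (z t) = 0 → m ≤ (weilQuadratic h).re)
    (hz : MemLp z 2) (hf : IsWeilTest f) (hfs : tsupport f ⊆ Icc (-a) a)
    (hfo : ∀ t, f (-t) = -f t) (hg : IsWeilTest g) (hgs : tsupport g ⊆ Icc (-a) a)
    (hgo : ∀ t, g (-t) = -g t)
    (horth : (∫ t, f t * conj (z t)) + μ * ∫ t, g t * conj (z t) = 0) :
    m * ((∫ t, ‖f t‖ ^ 2) + ‖μ‖ ^ 2 * (∫ t, ‖g t‖ ^ 2) +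
        2 * (conj μ * ∫ t, f t * conj (g t)).re) ≤
      (weilQuadratic f).re + ‖μ‖ ^ 2 * (weilQuadratic g).re +
        2 * (μ * weilFunctional (weilConv g (weilReflect f))).re := by
  have hfm : MemLp f 2 := isWeilTest_memLp hf
  have hgm : MemLp g 2 := isWeilTest_memLp hg
  have hwt : IsWeilTest (f + fun t => μ * g t) := hf.add (hg.const_mul _)
  have hws : tsupport (f + fun t => μ * g t) ⊆ Icc (-a) a :=
    (tsupport_add _ _).trans (union_subset hfs (tsupport_mul_subset_right.trans hgs))
  have hwo : ∀ t, (f + fun t => μ * g t) (-t) = -(f + fun t => μ * g t) t := fun t => by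
    simp only [Pi.add_apply, hfo, hgo]
    ring
  have horth' : ∫ t, (f + fun t => μ * g t) t * conj (z t) = 0 := by
    have e1 : (fun t => (f + fun t => μ * g t) t * conj (z t)) =
        fun t => f t * conj (z t) + μ * (g t * conj (z t)) := by
      funext t
      simp only [Pi.add_apply]
      ring
    have i1 : Integrable fun t => f t * conj (z t) := hfm.integrable_mul (memLp_conj hz)
    have i2 : Integrable fun t => μ * (g t * conj (z t)) :=
      (hgm.integrable_mul (memLp_conj hz)).const_mul μ
    rw [e1, integral_add i1 i2, integral_const_mul]
    exact horth
  have h1 := mul_integral_norm_sq_le_re_of_orthogonal H hwt hws hwo horth'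
  rw [re_weilQuadratic_add_const_mul hf hg μ] at h1
  have e2 : ∫ t, ‖(f + fun t => μ * g t) t‖ ^ 2 = (∫ t, ‖f t‖ ^ 2) +
      ‖μ‖ ^ 2 * (∫ t, ‖g t‖ ^ 2) + 2 * (conj μ * ∫ t, f t * conj (g t)).re := by
    have h2 := integral_norm_sq_add_mul hfm hgm μ
    rw [Complex.normSq_eq_norm_sq] at h2
    simpa only [Pi.add_apply] using h2
  rwa [e2] at h1

/-- **A relative odd gap is never orthogonal to the ground state.** If `u` is an odd-sector ground
state at window `a` (energy `ε`), `z ∈ L²`, and `Re Q ≥ m > ε` on the `L²`-normalised smooth odd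
window tests orthogonal to `z`, then `⟨u, z⟩ = ∫ u z̄ ≠ 0`. Otherwise, along the odd minimising sequence
`kₙ → u` of the weak Euler–Lagrange identity, the tests `kₙ − (⟨kₙ, z⟩/⟨e, z⟩) e ⊥ z` (for an odd
window test `e` with `⟨e, z⟩ ≠ 0`; if there is none the hypothesis holds on the whole odd sphere) have
`m ∫|·|² ≤ Re Q(·)`, and in the limit (`⟨kₙ, z⟩ → 0`, `W(e ⋆ k̃ₙ) = conj W(kₙ ⋆ ẽ)` convergent)
`m ≤ ε`. [cite: Bombieri2000Weil, §4 Lemma 1 / (4.2), Thm 3 and Thm 5] -/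
theorem integral_mul_conj_ne_zero_of_oddGap {a m : ℝ} {u z : ℝ → ℂ}
    (hu : IsWeilOddGroundState a u) (hz : MemLp z 2) (hm : weilOddGroundEnergy a < m)
    (H : ∀ h : ℝ → ℂ, IsWeilTest h → tsupport h ⊆ Icc (-a) a → (∀ t, h (-t) = -h t) →
      ∫ t, ‖h t‖ ^ 2 = (1 : ℝ) → ∫ t, h t * conj (z t) = 0 → m ≤ (weilQuadratic h).re) :
    (∫ t, u t * conj (z t)) ≠ 0 := by
  intro h0
  have ha : 0 < a := hu.pos
  obtain ⟨k, hk, hQ, hL, hEL⟩ := hu.exists_eulerLagrange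
  have hum : MemLp u 2 := hu.memLp
  have hkm : ∀ n, MemLp (k n) 2 := fun n => isWeilTest_memLp (hk n).1
  by_cases hex : ∃ e : ℝ → ℂ, IsWeilTest e ∧ tsupport e ⊆ Icc (-a) a ∧ (∀ t, e (-t) = -e t) ∧
      (∫ t, e t * conj (z t)) ≠ 0
  · obtain ⟨e, he, hes, heo, hpe⟩ := hex
    have hem : MemLp e 2 := isWeilTest_memLp he
    -- `⟨kₙ, z⟩ → ⟨u, z⟩ = 0`, so `μₙ := -⟨kₙ, z⟩/⟨e, z⟩ → 0`
    have hkz : Tendsto (fun n => ∫ t, k n t * conj (z t)) atTop (𝓝 0) := by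
      have h1 : Tendsto (fun n => ∫ t, k n t * conj (z t)) atTop (𝓝 (∫ t, u t * conj (z t))) :=
        tendsto_integral_mul_conj_left hz hum hkm hL
      rwa [h0] at h1
    have hμ : Tendsto (fun n => -((∫ t, k n t * conj (z t)) / ∫ t, e t * conj (z t))) atTop
        (𝓝 0) := by
      have h1 := (hkz.div_const (∫ t, e t * conj (z t))).neg
      rwa [zero_div, neg_zero] at h1
    -- the pairing `⟨kₙ, e⟩` and the cross term `W(e ⋆ k̃ₙ) = conj W(kₙ ⋆ ẽ)` converge
    have hP : Tendsto (fun n => ∫ t, k n t * conj (e t)) atTop (𝓝 (∫ t, u t * conj (e t))) :=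
      tendsto_integral_mul_conj_left hem hum hkm hL
    have hA : Tendsto (fun n => weilFunctional (weilConv e (weilReflect (k n)))) atTop
        (𝓝 (conj ((weilOddGroundEnergy a : ℂ) * ∫ t, u t * conj (e t)))) :=
      ((Complex.continuous_conj.tendsto _).comp (hEL e he hes)).congr fun n =>
        (weilFunctional_weilConv_weilReflect_swap (k n) e).symm
    have hstep : ∀ n, m * (1 + ‖-((∫ t, k n t * conj (z t)) / ∫ t, e t * conj (z t))‖ ^ 2 *
        (∫ t, ‖e t‖ ^ 2) + 2 * (conj (-((∫ t, k n t * conj (z t)) / ∫ t, e t * conj (z t))) *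
          ∫ t, k n t * conj (e t)).re) ≤
        (weilQuadratic (k n)).re +
          ‖-((∫ t, k n t * conj (z t)) / ∫ t, e t * conj (z t))‖ ^ 2 * (weilQuadratic e).re +
          2 * (-((∫ t, k n t * conj (z t)) / ∫ t, e t * conj (z t)) *
            weilFunctional (weilConv e (weilReflect (k n)))).re := fun n => by
      have h1 := gapTransfer_step _ H hz (hk n).1 (hk n).2.1 (hk n).2.2.1 he hes heo
        (by rw [neg_mul, div_mul_cancel₀ _ hpe, add_neg_cancel])
      rwa [(hk n).2.2.2] at h1
    have key := gapTransfer_limit hμ hA hP hQ tendsto_const_nhds (Eventually.of_forall hstep)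
    norm_num at key
    exact absurd key (not_le.2 hm)
  · push Not at hex
    exact absurd (le_weilOddGroundEnergy_of_forall ha fun g hg hs ho hn =>
      H g hg hs ho hn (hex g hg hs ho)) (not_le.2 hm)

/-- **Gap transfer from `z` to the ground state.** Let `u` be an odd-sector ground state at window
`a` (energy `ε`), `z ∈ L²`, and suppose `Re Q ≥ m > ε` on the `L²`-normalised smooth odd window tests
orthogonal to `z`. Then `Re Q(h) ≥ m` for every normalised smooth odd window test `h ⊥ u`: since
`⟨u, z⟩ ≠ 0` (`integral_mul_conj_ne_zero_of_oddGap`), along the odd minimising sequence `kₙ → u` of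
the weak Euler–Lagrange identity the tests `hₙ = h − (⟨h, z⟩/⟨kₙ, z⟩) kₙ` are exactly `⊥ z`, so
`m ∫|hₙ|² ≤ Re Q(hₙ)`; expand (`gapTransfer_step`) and let `n → ∞` (`W(kₙ ⋆ h̃) → ε ⟨u, h⟩‾ = 0`,
`⟨h, kₙ⟩ → ⟨h, u⟩ = 0`): `m + (m − ε)|⟨h, z⟩/⟨u, z⟩|² ≤ Re Q(h)` — the variational form of "the
second min–max level dominates the infimum over any codimension-one slice".
[cite: Bombieri2000Weil, §4 Lemma 1 / (4.2), Thm 3 and Thm 5] -/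
theorem gapTransfer {a m : ℝ} {u z : ℝ → ℂ} (hu : IsWeilOddGroundState a u) (hz : MemLp z 2)
    (hm : weilOddGroundEnergy a < m)
    (H : ∀ h : ℝ → ℂ, IsWeilTest h → tsupport h ⊆ Icc (-a) a → (∀ t, h (-t) = -h t) →
      ∫ t, ‖h t‖ ^ 2 = (1 : ℝ) → ∫ t, h t * conj (z t) = 0 → m ≤ (weilQuadratic h).re)
    {h : ℝ → ℂ} (hh : IsWeilTest h) (hhs : tsupport h ⊆ Icc (-a) a) (hho : ∀ t, h (-t) = -h t)
    (hh1 : ∫ t, ‖h t‖ ^ 2 = (1 : ℝ)) (horth : ∫ t, h t * conj (u t) = 0) :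
    m ≤ (weilQuadratic h).re := by
  have hzu : (∫ t, u t * conj (z t)) ≠ 0 := integral_mul_conj_ne_zero_of_oddGap hu hz hm H
  obtain ⟨k, hk, hQ, hL, hEL⟩ := hu.exists_eulerLagrange
  have hum : MemLp u 2 := hu.memLp
  have hhm : MemLp h 2 := isWeilTest_memLp hh
  have hkm : ∀ n, MemLp (k n) 2 := fun n => isWeilTest_memLp (hk n).1
  set ζ : ℂ := ∫ t, u t * conj (z t) with hζ
  set ph : ℂ := ∫ t, h t * conj (z t) with hph
  set c : ℕ → ℂ := fun n => ∫ t, k n t * conj (z t) with hc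
  -- `cₙ = ⟨kₙ, z⟩ → ζ ≠ 0`, `μₙ := -ph / cₙ → -ph / ζ`, `⟨h, kₙ⟩ → ⟨h, u⟩ = 0`
  have hcζ : Tendsto c atTop (𝓝 ζ) := tendsto_integral_mul_conj_left hz hum hkm hL
  have hμ : Tendsto (fun n => -(ph / c n)) atTop (𝓝 (-(ph / ζ))) :=
    (Filter.Tendsto.div tendsto_const_nhds hcζ hzu).neg
  have hP : Tendsto (fun n => ∫ t, h t * conj (k n t)) atTop (𝓝 (∫ t, h t * conj (u t))) :=
    tendsto_integral_mul_conj hhm hum hkm hL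
  -- `∫ u h̄ = conj ⟨h, u⟩ = 0`, so `W(kₙ ⋆ h̃) → ε ∫ u h̄ = 0` (weak Euler–Lagrange)
  have hconj : ∫ t, u t * conj (h t) = conj (∫ t, h t * conj (u t)) := by
    rw [← integral_conj]
    refine integral_congr_ae (Eventually.of_forall fun t => ?_)
    simp only [map_mul, Complex.conj_conj]
    exact mul_comm _ _
  rw [horth, map_zero] at hconj
  -- the hypothesis at `hₙ = h + μₙ kₙ ⊥ z`, expanded
  have hstep : ∀ᶠ n in atTop,
      m * (1 + ‖-(ph / c n)‖ ^ 2 * 1 + 2 * (conj (-(ph / c n)) * ∫ t, h t * conj (k n t)).re) ≤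
        (weilQuadratic h).re + ‖-(ph / c n)‖ ^ 2 * (weilQuadratic (k n)).re +
          2 * (-(ph / c n) * weilFunctional (weilConv (k n) (weilReflect h))).re := by
    filter_upwards [hcζ.eventually_ne hzu] with n hn
    have h1 := gapTransfer_step (-(ph / c n)) H hz hh hhs hho (hk n).1 (hk n).2.1 (hk n).2.2.1
      (by
        change ph + -(ph / c n) * c n = 0
        rw [neg_mul, div_mul_cancel₀ ph hn, add_neg_cancel])
    rwa [hh1, (hk n).2.2.2] at h1
  have key := gapTransfer_limit hμ (hEL h hh hhs) hP tendsto_const_nhds hQ hstep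
  rw [hconj, horth] at key
  simp only [mul_zero, Complex.zero_re, add_zero, mul_one] at key
  nlinarith [key, sq_nonneg ‖-(ph / ζ)‖, hm]

/-- **Proximity from tightness** (curried form over tree vocabulary; pairing written `∫ ū w`). Let `u`
be an odd-sector ground state at window `a` with `ε = weilOddGroundEnergy a > 0`, `v : Fin K → ℝ → ℂ`
square integrable, `θ, Δ > 0`, `q = θe^{-4a}`. Assume two-level proximity for `u` (P1, hypothesis
`hP1`), clause (i): every eventual lower bound `R` of `Re Q` along every sequence of odd unit window
tests converging in `L²` to a unit vector of the span of `v` has `R/(1+q) ≤ Re Q` on the odd unit test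
sphere, and clause (ii'): `Re Q ≥ (1+Δ)ε` on the odd unit tests orthogonal to some `z ∈ L²`. Then some
unit `w = Σ cᵢ vᵢ` has `1 − |∫ ū w|² ≤ 2q/Δ` (sup of the admissible `R` + gap transfer + P1 along a
recovery sequence; see the module docstring). [cite: Bombieri2000Weil, §4 Lemma 1 / (4.2), Thm 3, 5] -/
theorem proximityOfTight {θ Δ a : ℝ} {K : ℕ} {u : ℝ → ℂ} {v : Fin K → ℝ → ℂ}
    (hθ : 0 < θ) (hΔ : 0 < Δ) (hu : IsWeilOddGroundState a u)
    (hε : 0 < weilOddGroundEnergy a) (hvm : ∀ i, MemLp (v i) 2)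
    (hP1 : ∀ m₂ : ℝ, weilOddGroundEnergy a < m₂ →
        (∀ h : ℝ → ℂ, IsWeilTest h → tsupport h ⊆ Icc (-a) a → (∀ t, h (-t) = -h t) →
          ∫ t, ‖h t‖ ^ 2 = (1 : ℝ) → ∫ t, conj (u t) * h t = 0 →
            m₂ ≤ (weilQuadratic h).re) →
        ∀ w : ℝ → ℂ, IsWeilTest w → tsupport w ⊆ Icc (-a) a → (∀ t, w (-t) = -w t) →
          ∫ t, ‖w t‖ ^ 2 = (1 : ℝ) →
            1 - ‖∫ t, conj (u t) * w t‖ ^ 2 ≤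
              ((weilQuadratic w).re - weilOddGroundEnergy a) / (m₂ - weilOddGroundEnergy a))
    (hRi : ∀ R : ℝ,
        (∀ c : Fin K → ℂ, (∫ t, ‖∑ i, c i * v i t‖ ^ 2 = (1 : ℝ)) →
          ∀ g : ℕ → ℝ → ℂ, (∀ n, IsWeilTest (g n) ∧ tsupport (g n) ⊆ Icc (-a) a ∧
              (∀ t, g n (-t) = -g n t) ∧ ∫ t, ‖g n t‖ ^ 2 = (1 : ℝ)) →
            Tendsto (fun n => ∫ t, ‖g n t - ∑ i, c i * v i t‖ ^ 2) atTop (𝓝 0) →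
              ∀ δ : ℝ, 0 < δ → ∀ᶠ n in atTop, R - δ ≤ (weilQuadratic (g n)).re) →
        ∀ h : ℝ → ℂ, IsWeilTest h ∧ tsupport h ⊆ Icc (-a) a ∧ (∀ t, h (-t) = -h t) ∧
          ∫ t, ‖h t‖ ^ 2 = (1 : ℝ) → R / (1 + θ * Real.exp (-4 * a)) ≤ (weilQuadratic h).re)
    (hgap : ∃ z : ℝ → ℂ, MemLp z 2 ∧ ∀ h : ℝ → ℂ, IsWeilTest h ∧ tsupport h ⊆ Icc (-a) a ∧
        (∀ t, h (-t) = -h t) ∧ ∫ t, ‖h t‖ ^ 2 = (1 : ℝ) →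
          ∫ t, conj (z t) * h t = 0 → (1 + Δ) * weilOddGroundEnergy a ≤ (weilQuadratic h).re) :
    ∃ c : Fin K → ℂ, (∫ t, ‖∑ i, c i * v i t‖ ^ 2 = (1 : ℝ)) ∧
      1 - ‖∫ t, conj (u t) * ∑ i, c i * v i t‖ ^ 2 ≤ 2 * θ * Real.exp (-4 * a) / Δ := by
  have ha : 0 < a := hu.pos
  have hum : MemLp u 2 := hu.memLp
  set ε : ℝ := weilOddGroundEnergy a with hε_def
  set q : ℝ := θ * Real.exp (-4 * a) with hq_def
  have hq : 0 < q := mul_pos hθ (Real.exp_pos _)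
  have hq1 : (0 : ℝ) < 1 + q := by linarith
  -- the two pairing conventions `∫ f̄ g = ∫ g f̄`
  have hcomm : ∀ f g : ℝ → ℂ, ∫ t, conj (f t) * g t = ∫ t, g t * conj (f t) :=
    fun f g => integral_congr_ae (Eventually.of_forall fun t => mul_comm _ _)
  -- gap transfer: the second level `(1 + Δ) ε` bounds `Re Q` on `u^⊥`; P1 applies
  obtain ⟨z, hz, hgz⟩ := hgap
  have hm : ε < (1 + Δ) * ε := by nlinarith [mul_pos hΔ hε]
  have Hz : ∀ h : ℝ → ℂ, IsWeilTest h → tsupport h ⊆ Icc (-a) a → (∀ t, h (-t) = -h t) →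
      ∫ t, ‖h t‖ ^ 2 = (1 : ℝ) → ∫ t, h t * conj (z t) = 0 →
        (1 + Δ) * ε ≤ (weilQuadratic h).re :=
    fun h hh hs ho h1 h0 => hgz h ⟨hh, hs, ho, h1⟩ ((hcomm z h).trans h0)
  have hprox := hP1 ((1 + Δ) * ε) hm fun h hh hs ho h1 h0 =>
    gapTransfer hu hz hm Hz hh hs ho h1 ((hcomm u h).symm.trans h0)
  -- the admissible energy lower bounds of the unit vectors of the block span
  obtain ⟨adm, hadm⟩ : ∃ adm : ℝ → Prop, ∀ R, adm R ↔
      ∀ c : Fin K → ℂ, (∫ t, ‖∑ i, c i * v i t‖ ^ 2 = (1 : ℝ)) →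
        ∀ g : ℕ → ℝ → ℂ, (∀ n, IsWeilTest (g n) ∧ tsupport (g n) ⊆ Icc (-a) a ∧
            (∀ t, g n (-t) = -g n t) ∧ ∫ t, ‖g n t‖ ^ 2 = (1 : ℝ)) →
          Tendsto (fun n => ∫ t, ‖g n t - ∑ i, c i * v i t‖ ^ 2) atTop (𝓝 0) →
            ∀ δ : ℝ, 0 < δ → ∀ᶠ n in atTop, R - δ ≤ (weilQuadratic (g n)).re :=
    ⟨_, fun R => Iff.rfl⟩
  -- `ε` is admissible; the admissible set is bounded above (clause (i) at one odd unit test)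
  have hεadm : adm ε := (hadm ε).2 fun c _ g hg _ δ hδ => Eventually.of_forall fun n => by
    have hle : ε ≤ (weilQuadratic (g n)).re :=
      weilOddGroundEnergy_le (hg n).1 (hg n).2.1 (hg n).2.2.1 (hg n).2.2.2
    linarith
  obtain ⟨h₀, hh₀, hh₀s, hh₀o, hh₀1⟩ := exists_isWeilTest_odd_sphere ha
  have hbound : ∀ R, adm R → R ≤ (weilQuadratic h₀).re * (1 + q) := fun R hR => by
    have h1 : R / (1 + q) ≤ (weilQuadratic h₀).re :=
      hRi R ((hadm R).1 hR) h₀ ⟨hh₀, hh₀s, hh₀o, hh₀1⟩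
    rwa [div_le_iff₀ hq1] at h1
  -- its supremum `Rs` is admissible, hence `Rs ≤ (1 + q) ε`, and `Rs + qε` is not admissible
  obtain ⟨Rs, hlub⟩ : ∃ Rs : ℝ, IsLUB {R | adm R} Rs :=
    ⟨_, isLUB_csSup ⟨ε, hεadm⟩ ⟨_, fun R hR => hbound R hR⟩⟩
  have hRsadm : adm Rs := (hadm Rs).2 fun c hc g hg hL δ hδ => by
    obtain ⟨R, hR, hlt, -⟩ := hlub.exists_between (show Rs - δ / 2 < Rs by linarith)
    filter_upwards [(hadm R).1 hR c hc g hg hL (δ / 2) (by linarith)] with n hn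
    linarith
  have hRsle : Rs ≤ ε * (1 + q) := by
    have h1 : Rs / (1 + q) ≤ ε :=
      le_weilOddGroundEnergy_of_forall ha fun g hg hs ho hn =>
        hRi Rs ((hadm Rs).1 hRsadm) g ⟨hg, hs, ho, hn⟩
    rwa [div_le_iff₀ hq1] at h1
  have hnot : ¬ adm (Rs + q * ε) := fun hmem => by
    have h1 : Rs + q * ε ≤ Rs := hlub.1 hmem
    nlinarith [mul_pos hq hε]
  rw [hadm] at hnot
  push Not at hnot
  obtain ⟨c, hc, g, hg, hL, δ, hδ, hfreq⟩ := hnot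
  refine ⟨c, hc, ?_⟩
  -- the unit vector `w = Σ cᵢ vᵢ ∈ L²` and the pairing limit `∫ ū gₙ → ∫ ū w`
  have hwm : MemLp (fun t => ∑ i, c i * v i t) 2 :=
    memLp_finsetSum Finset.univ fun i _ => (hvm i).const_mul (c i)
  have hgm : ∀ n, MemLp (g n) 2 := fun n => isWeilTest_memLp (hg n).1
  have hpair : Tendsto (fun n => ∫ t, conj (u t) * g n t) atTop
      (𝓝 (∫ t, conj (u t) * ∑ i, c i * v i t)) := by
    have h1 : Tendsto (fun n => ∫ t, g n t * conj (u t)) atTop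
        (𝓝 (∫ t, (∑ i, c i * v i t) * conj (u t))) :=
      tendsto_integral_mul_conj_left hum hwm hgm hL
    rw [show (fun n => ∫ t, conj (u t) * g n t) = fun n => ∫ t, g n t * conj (u t) from
      funext fun n => hcomm u (g n), hcomm u]
    exact h1
  have hF : Tendsto (fun n => 1 - ‖∫ t, conj (u t) * g n t‖ ^ 2) atTop
      (𝓝 (1 - ‖∫ t, conj (u t) * ∑ i, c i * v i t‖ ^ 2)) :=
    tendsto_const_nhds.sub ((hpair.norm).pow 2)
  -- two-level proximity along `gₙ`: frequently below `2q/Δ`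
  have hΔε : 0 < (1 + Δ) * ε - ε := by nlinarith [mul_pos hΔ hε]
  refine le_of_tendsto_of_frequently_lt hF (hfreq.mono fun n hn => ?_)
  refine (hprox (g n) (hg n).1 (hg n).2.1 (hg n).2.2.1 (hg n).2.2.2).trans_lt ?_
  rw [div_lt_div_iff₀ hΔε hΔ]
  have h2 : (weilQuadratic (g n)).re - ε < 2 * q * ε := by nlinarith
  calc ((weilQuadratic (g n)).re - ε) * Δ < 2 * q * ε * Δ := mul_lt_mul_of_pos_right h2 hΔ
    _ = 2 * θ * Real.exp (-4 * a) * ((1 + Δ) * ε - ε) := by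
      rw [hq_def]
      ring

/-- **Stub K2a — proximity from tightness (RH-free).** With the card's predicates inlined (`Tight` in
its v2 form (o) ∧ (i) ∧ (ii')) and two-level proximity (P1) as hypothesis: if `Tight θ Δ K a` holds and
`u` is any odd-sector ground state at `a`, then some unit vector `w = Σ cᵢ vᵢ` of the odd prolate
block's span is `L²`-close to `u`: `1 − |⟨u, w⟩|² ≤ 2θe^{-4a}/Δ` (`R* := sup` of the admissible `R`
is admissible, so `R* ≤ (1+θe^{-4a})ε₁` by (i); `R* + θe^{-4a}ε₁` is not, giving odd unit tests
`gₙ → w` with `Re Q(gₙ) < (1+2θe^{-4a})ε₁` frequently; the gap (ii') transfers from `z` to `u`, so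
P1 applies with `m₂ = (1+Δ)ε₁`; pass to the limit in `⟨u, gₙ⟩`). Registered uncurried form of
`proximityOfTight`. [cite: Bombieri2000Weil, §4 Lemma 1 / (4.2), Thm 3 and Thm 5] -/
theorem stub_proximityOfTight :
    let IsSincEigen : ℝ → ℕ → (ℝ → ℝ) → ℝ → Prop := fun c k ψ μ =>
      ContinuousOn ψ (Icc (-1) 1) ∧ (∀ x, ψ (-x) = ψ x) ∧ (∫ x in Icc (-1 : ℝ) 1, ψ x ^ 2 = 1) ∧
        (∀ x ∈ Icc (-1 : ℝ) 1, ∫ y in Icc (-1 : ℝ) 1,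
          (if x = y then c / Real.pi else Real.sin (c * (x - y)) / (Real.pi * (x - y))) * ψ y =
            μ * ψ x) ∧
        {x : ℝ | x ∈ Ioo (0 : ℝ) 1 ∧ ψ x = 0}.ncard = k ∧ {x : ℝ | x ∈ Ioo (0 : ℝ) 1 ∧ ψ x = 0}.Finite
    let IsSeed : ℝ → ℕ → (ℝ → ℝ) → Prop := fun lam m φ =>
      ∃ (ψ₁ ψ : ℝ → ℝ) (μ₁ μ : ℝ), IsSincEigen (2 * Real.pi * lam ^ 2) 1 ψ₁ μ₁ ∧
        IsSincEigen (2 * Real.pi * lam ^ 2) (2 * m + 1) ψ μ ∧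
        ∀ y, φ y = if |y| ≤ lam then ψ (y / lam) * ψ₁ 0 - ψ₁ (y / lam) * ψ 0 else 0
    let IsVec : ℝ → ℕ → (ℝ → ℂ) → Prop := fun a m v =>
      ∃ (φ : ℝ → ℝ) (N : ℝ), IsSeed (Real.exp a) m φ ∧ 0 < N ∧ MemLp v 2 ∧
        (∀ t, v t = if |t| ≤ a then
          (((N / 2) * (Real.exp (t / 2) * ∑' n : ℕ, φ ((n + 1 : ℕ) * Real.exp t) -
            Real.exp (-t / 2) * ∑' n : ℕ, φ ((n + 1 : ℕ) * Real.exp (-t))) : ℝ) : ℂ) else 0) ∧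
        ∫ t, ‖v t‖ ^ 2 = (1 : ℝ)
    let IsTest : ℝ → (ℝ → ℂ) → Prop := fun a h =>
      IsWeilTest h ∧ tsupport h ⊆ Icc (-a) a ∧ (∀ t, h (-t) = -h t) ∧ ∫ t, ‖h t‖ ^ 2 = (1 : ℝ)
    let IsELB : ℝ → (ℝ → ℂ) → ℝ → Prop := fun a w R =>
      ∀ g : ℕ → ℝ → ℂ, (∀ n, IsTest a (g n)) →
        Tendsto (fun n => ∫ t, ‖g n t - w t‖ ^ 2) atTop (𝓝 0) →
          ∀ δ : ℝ, 0 < δ → ∀ᶠ n in atTop, R - δ ≤ (weilQuadratic (g n)).re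
    let Tight : ℝ → ℝ → ℕ → ℝ → Prop := fun θ Δ K a =>
      0 < weilOddGroundEnergy a ∧
      ∃ v : Fin K → ℝ → ℂ, (∀ i : Fin K, IsVec a ((i : ℕ) + 1) (v i)) ∧
        (∀ R : ℝ, (∀ c : Fin K → ℂ, (∫ t, ‖∑ i, c i * v i t‖ ^ 2 = (1 : ℝ)) →
            IsELB a (fun t => ∑ i, c i * v i t) R) →
          ∀ h : ℝ → ℂ, IsTest a h → R / (1 + θ * Real.exp (-4 * a)) ≤ (weilQuadratic h).re) ∧
        (∃ z : ℝ → ℂ, MemLp z 2 ∧ ∀ h : ℝ → ℂ, IsTest a h →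
          ∫ t, (starRingEnd ℂ) (z t) * h t = 0 → (1 + Δ) * weilOddGroundEnergy a ≤ (weilQuadratic h).re)
    (∀ (a : ℝ) (u : ℝ → ℂ), IsWeilOddGroundState a u →
      ∀ m₂ : ℝ, weilOddGroundEnergy a < m₂ →
        (∀ h : ℝ → ℂ, IsWeilTest h → tsupport h ⊆ Icc (-a) a → (∀ t, h (-t) = -h t) →
          ∫ t, ‖h t‖ ^ 2 = (1 : ℝ) → ∫ t, (starRingEnd ℂ) (u t) * h t = 0 →
            m₂ ≤ (weilQuadratic h).re) →
        ∀ v : ℝ → ℂ, IsWeilTest v → tsupport v ⊆ Icc (-a) a → (∀ t, v (-t) = -v t) →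
          ∫ t, ‖v t‖ ^ 2 = (1 : ℝ) →
            1 - ‖∫ t, (starRingEnd ℂ) (u t) * v t‖ ^ 2 ≤
              ((weilQuadratic v).re - weilOddGroundEnergy a) / (m₂ - weilOddGroundEnergy a)) →
    ∀ (θ Δ : ℝ) (K : ℕ) (a : ℝ) (u : ℝ → ℂ), 0 < θ → 0 < Δ → Tight θ Δ K a →
      IsWeilOddGroundState a u →
        ∃ v : Fin K → ℝ → ℂ, (∀ i : Fin K, IsVec a ((i : ℕ) + 1) (v i)) ∧
          ∃ c : Fin K → ℂ, (∫ t, ‖∑ i, c i * v i t‖ ^ 2 = (1 : ℝ)) ∧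
            1 - ‖∫ t, (starRingEnd ℂ) (u t) * ∑ i, c i * v i t‖ ^ 2 ≤
              2 * θ * Real.exp (-4 * a) / Δ := by
  intro _ _ IsVec IsTest IsELB Tight hP1 θ Δ K a u hθ hΔ hT hu
  obtain ⟨hε, v, hv, hRi, hgap⟩ := hT
  have hvm : ∀ i : Fin K, MemLp (v i) 2 := fun i => by
    obtain ⟨_, _, -, -, hm, -, -⟩ := hv i
    exact hm
  obtain ⟨c, hc, hle⟩ := proximityOfTight hθ hΔ hu hε hvm (hP1 a u hu) hRi hgap
  exact ⟨v, hv, c, hc, hle⟩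

end Summit.RiemannHypothesis.RiemannHypothesis.Theorems.OddSector

end
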